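import Mathlib.FieldTheory.IsAlgClosed.Spectrum
import Mathlib.RingTheory.IntegralClosure.Algebra.Basic
import Literature.MathematicalPhysics.QuantumFieldTheory.Balaban1983to89.B9Thm311SmallFieldPathZdContinuity

/-!
# `Balaban1983to89.B9Eq336GaugeOrbitConnectedZd` — [Balaban1985BackgroundPropagators] (3.36) p. 396 ∕ Thm 3.11 p. 416 AT THE `ℤᵈ × 𝔸` CARRIER: THE UNITARY
# GROUP OF A FINITE-DIMENSIONAL C⋆-ALGEBRA IS PATH CONNECTED, hence the unitary GAUGE GROUP of `ℤᵈ` and every GAUGE ORBIT are path connected, hence the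
# `δ`-NEIGHBOURHOOD OF THE PURE-GAUGE ORBIT — (3.36)'s class «`U^u = e^{iηA}`, `|A|` small, for SOME gauge `u`» read on all of `ℤᵈ` — is ONE path-connected,
# gauge-invariant family inside the regime `𝒰′` containing the flat background; the continuity-method reduction runs on it verbatim

statement-level skeleton of published theorems with citation tags; proofs where landed; nothing here is a claim about the
Yang–Mills mass gap

T. Bałaban, *Propagators for lattice gauge theories in a background field*, Commun. Math. Phys. **99** (1985) 389–434 [`Balaban1985BackgroundPropagators`,
"B9"] p. 396 (3.34)–(3.36): *«Δ_a(U^u) = R(u)Δ_a(U)R(u⁻¹), G(U^u) = R(u)G(U)R(u⁻¹) (3.34) … there exists a gauge transformation u defined on □ … such that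
U^u = e^{iηA} and |A| < O(1)Mα₀ (3.36)»*; p. 416 Theorem 3.11.  T. Bałaban, *Averaging operations for lattice gauge theories*, CMP **98** (1985) 17–51
[`Balaban1985Averaging`] p. 18 (*«gauge field configurations with values in G = U(N)»*, (8) the gauge action), (22)–(23) p. 21 (the finite spectral
decomposition `U = Σ_j e^{iλ_j}P_j`, `λ_j ∈ ]−π, π]`).  PDF held: `paper:balaban1985-cmp99-background-propagators` pp. 396, 416.

CITATION HEADER ∕ WHY THIS FILE (cell `pub-ymgap`, HUMAN RULING D-0062 ∕ D-0149; width seat `pub-ymgap-dag-n06-w3` (g4), node N06 = [B9]; CLAIM-2; count-neutral).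
The companions `B9Thm311SmallFieldPathZd(Continuity)` (CLAIM-1) make every uniform ball and each of its gauge translates a preconnected subset of `𝒰′` — one
family PER pure gauge.  THIS FILE glues them into ONE gauge-invariant family `𝒩_δ = ⋃_w (B_δ)^w` by proving that the pure-gauge orbit itself is path
connected, which rests on the connectedness of print's structure group: the unitary group of a FINITE-DIMENSIONAL C⋆-algebra (`U(N)`, `⊕ M_{nᵢ}(ℂ)`) is path
connected — every unitary has finite spectrum, so a scalar rotation moves `−1` off it and Mathlib's radial `Unitary.path` (J. Loreaux 2025,
`Analysis/CStarAlgebra/Unitary/Connected`) reaches it from `1`.  dag-n06-w4 g3's reduction `B9Thm311ContinuityMethodZd.bondPair_pos_on_reg17UnivP_of_coercive`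
then applies to `S = 𝒩_δ` verbatim (base point `1 ∈ 𝒩_δ`).  dag-n06-w4 g4's `B9Eq335UnitaryClassCompactZd.isCompact_unitaryUnits` (p617890) is the
compactness half of «`G` compact connected»; nothing of it is restated (connectedness is proved here from the spectrum, not from compactness).
INPUTS BY NAME: Mathlib (`spectrum.subset_polynomial_aeval`, `minpoly.aeval`, `IsIntegral.of_finite`, `Unitary.norm_sub_one_lt_two_iff`, `spectrum.smul_eq_smul`,
`Circle.arg_exp`, `Unitary.joined`, `IsPathConnected.pi ∕ .image`, `Module.Finite.of_restrictScalars_finite`), the companions' `one_mem_ball`,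
`joinedIn_image_ball_gaugeAct_one`, `gaugeAct_one_mem_image_ball`, `image_ball_subset_reg17UnivP`, `delta_le_two_of_window`, this seat's g3
`B9Eq333ProjectionCovarianceZd.gaugeAct_inv_gaugeAct`.

WHAT IS PROVED (kernel, 0 sorry; theorems only — no `def`, `instance`, `notation`).
* §1 `spectrum_finite` (finite `ℂ`-module C⋆-algebra) · `smul_mem_unitary` · ★ `exists_smul_norm_sub_one_lt_two` · ★★ `joined_one_unitary` ·
  ★★ `pathConnectedSpace_unitary` (a theorem; no instance registered) · `continuous_toUnits` · ★★ `isPathConnected_unitaryUnits`.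
* §2 ★★ `isPathConnected_gaugeGroup` · `continuous_gaugeAct_left` · ★★ `isPathConnected_orbit` · `gaugeAct_gaugeAct` · `gaugeAct_one_left`.
* §3 (the class `𝒩_δ`, written as a set-builder over the companions' ball) `one_mem_orbitBall` · `image_ball_subset_orbitBall` · `orbit_one_subset_orbitBall` ·
  ★ `gaugeAct_mem_orbitBall` (gauge invariance) · ★★ `orbitBall_subset_reg17UnivP` (`4δ < (α_Q∕L²)L^{−2m}`) · ★★★ `isPathConnected_orbitBall` (`0 < δ ≤ 2`) ·
  `isPreconnected_orbitBall`.
* §4 `moduleFinite_complex` · ★★★ `bondPair_pos_on_orbitBall_of_coercive` ∕ ★★★ `regularAtH_on_orbitBall_of_coercive` — at every cube member (class `cubeLamBP`,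
  `m ≤ k`, `2 ≤ d`, `2 ≤ L ≤ ρ`), `0 < δ`, `4δ < (α_Q∕L²)L^{−2m}`: uniform coercivity at the positive points of `𝒩_δ` ⟹ the genuine `Δ_a(U₀)` positive definite
  on `E_𝔤(□₀)` (and `G_𝔤(U₀)` exists) for EVERY `U₀ ∈ 𝒩_δ`.

HONEST SCOPE.  Spectral bookkeeping + point-set topology + by-name composition; no estimate of [B9]; §4 is CONDITIONAL on the displayed coercivity (print's
(3.115)-type bound, NOT proved); `𝒩_δ ⊊ 𝒰′` in general and the preconnectedness of `𝒰′` itself stays OPEN (LOCATED in `B9Thm311SmallFieldPathZd`); for an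
infinite-dimensional `𝔸` §1 fails and is not claimed.  Count-neutral helper; N05 ∕ N06 NOT discharged; K1⁸ `stmt-QuantumFields-26907` NOT closed; one finite
`𝕋⁴` programme at fixed `ε`, Bałaban as printed; R4 closes only the conditional finite-`𝕋⁴` rung `BalabanLadder.UV` — nothing continuum ∕ ℝ⁴ ∕ OS ∕ mass gap ∕
Clay.  Unit `pub-ymgap-dag-n06-w3` (g4), 2026-08-28.
-/

noncomputable section

namespace Literature.MathematicalPhysics.QuantumFieldTheory.Balaban1983to89.B9Eq336GaugeOrbitConnectedZd

open scoped Topology Real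
open Filter Complex
open B7Prop1Explicit
open B7Prop2Explicit (unitaryUnits mem_unitaryUnits unitaryUnits_le_U1)
open B9Eq316AveragingTransposeZd (Reg17 alphaQ alphaQ_pos)
open B9Eq333ProjectionCovarianceZd (gaugeAct_inv_gaugeAct inv_mem_unitaryUnits)
open B9Thm311SmallFieldPathZd (one_mem_ball joinedIn_image_ball_gaugeAct_one gaugeAct_one_mem_image_ball image_ball_subset_reg17UnivP)
open B9Thm311SmallFieldPathZdContinuity (delta_le_two_of_window)

-- `Site` alone could resolve to the torus sites of `Setup.lean`; re-export the `ℤ^d` sites of `B7Prop1Explicit`.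
export B7Prop1Explicit (Site)

variable {𝔸 : Type*} [CStarAlgebra 𝔸]

/-! ## §1  The unitary group of a finite-dimensional C⋆-algebra is path connected -/

section Unitary

/-- in a C⋆-algebra that is a finite module over `ℂ`, every element has FINITE spectrum (inside the root set of its minimal polynomial, by the polynomial
spectral inclusion `p(σ(a)) ⊆ σ(p(a))`). [cite: Balaban1985Averaging, (22) p.21 («X = Σ_j z_j P_j, … a normal matrix»: the finite spectral decomposition) (bookkeeping)] -/
theorem spectrum_finite [Module.Finite ℂ 𝔸] (a : 𝔸) : (spectrum ℂ a).Finite := by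
  nontriviality 𝔸
  have hint : IsIntegral ℂ a := IsIntegral.of_finite ℂ a
  have hp0 : minpoly ℂ a ≠ 0 := minpoly.ne_zero hint
  refine ((minpoly ℂ a).rootSet_finite ℂ).subset fun z hz => ?_
  rw [Polynomial.mem_rootSet]
  refine ⟨hp0, ?_⟩
  have h := spectrum.subset_polynomial_aeval a (minpoly ℂ a) ⟨z, hz, rfl⟩
  rw [minpoly.aeval, spectrum.zero_eq, Set.mem_singleton_iff] at h
  simpa [Polynomial.aeval_def, Polynomial.eval₂_eq_eval_map] using h

/-- a unit scalar multiple of a unitary is unitary. [cite: Balaban1985Averaging, (23) p.21 («U = Σ_j e^{iλ_j} P_j») (bookkeeping)] -/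
theorem smul_mem_unitary {c : ℂ} (hc : ‖c‖ = 1) {u : 𝔸} (hu : u ∈ unitary 𝔸) : c • u ∈ unitary 𝔸 := by
  have hcc : star c * c = 1 := by
    rw [Complex.star_def, Complex.conj_mul', hc]; norm_num
  have hcc' : c * star c = 1 := by rw [mul_comm]; exact hcc
  rw [Unitary.mem_iff] at hu ⊢
  refine ⟨?_, ?_⟩
  · rw [star_smul, smul_mul_smul_comm, hu.1, hcc, one_smul]
  · rw [star_smul, smul_mul_smul_comm, hu.2, hcc', one_smul]

/-- ★ **EVERY UNITARY OF A FINITE-DIMENSIONAL C⋆-ALGEBRA HAS A UNIT SCALAR ROTATION WITHIN DISTANCE `< 2` OF `1`**: rotate `−1` off the (finite) spectrum —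
pick `θ ∈ (−π, π]` outside the finitely many `arg(−λ)`, `λ ∈ σ(u)`; then `−1 ∉ σ(e^{−iθ}u)`, i.e. `‖e^{−iθ}u − 1‖ < 2` (`Unitary.norm_sub_one_lt_two_iff`).
[cite: Balaban1985Averaging, (23) p.21 («λ_j ∈ ]−π, π]») (bookkeeping)] -/
theorem exists_smul_norm_sub_one_lt_two [Module.Finite ℂ 𝔸] {u : 𝔸} (hu : u ∈ unitary 𝔸) :
    ∃ θ : ℝ, ‖(Circle.exp θ : ℂ) • u - 1‖ < 2 := by
  nontriviality 𝔸
  have hF : ((fun z : ℂ => arg (-z)) '' spectrum ℂ u).Finite := (spectrum_finite u).image _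
  obtain ⟨θ, hθI, hθF⟩ : ∃ θ ∈ Set.Ioc (-π) π, θ ∉ (fun z : ℂ => arg (-z)) '' spectrum ℂ u :=
    ((Set.Ioc_infinite (by linarith [Real.pi_pos] : -π < π)).sdiff hF).nonempty.imp fun θ hθ => ⟨hθ.1, hθ.2⟩
  refine ⟨-θ, ?_⟩
  rw [Unitary.norm_sub_one_lt_two_iff (smul_mem_unitary (Circle.norm_coe _) hu)]
  intro hmem
  rw [spectrum.smul_eq_smul _ _ (spectrum.nonempty u)] at hmem
  obtain ⟨z, hz, hcz⟩ := hmem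
  apply hθF
  refine ⟨z, hz, ?_⟩
  have hc : (Circle.exp (-θ) : ℂ) * z = -1 := by simpa [smul_eq_mul] using hcz
  have hz' : -z = (Circle.exp θ : ℂ) := by
    have h1 : (Circle.exp θ : ℂ) * (Circle.exp (-θ) : ℂ) = 1 := by
      rw [← Circle.coe_mul, ← Circle.exp_add, add_neg_cancel, Circle.exp_zero, Circle.coe_one]
    calc -z = -((Circle.exp θ : ℂ) * (Circle.exp (-θ) : ℂ) * z) := by rw [h1, one_mul]
      _ = -((Circle.exp θ : ℂ) * ((Circle.exp (-θ) : ℂ) * z)) := by rw [mul_assoc]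
      _ = Circle.exp θ := by rw [hc]; ring
  show arg (-z) = θ
  rw [hz', Circle.arg_exp hθI.1 hθI.2]

/-- ★★ **THE UNITARY GROUP OF A FINITE-DIMENSIONAL C⋆-ALGEBRA IS PATH CONNECTED**: every unitary `u` is joined to `1` — the scalar rotation
`s ↦ e^{i(1−s)θ}u` from the rotated `v = e^{iθ}u` (within `2` of `1`) to `u`, after Mathlib's radial `Unitary.path 1 v`.  (`G = U(N)`, or the unitary group of
any `𝔸 = ⊕ M_{nᵢ}(ℂ)`, is connected; for a general unital C⋆-algebra this fails.) [cite: Balaban1985Averaging, p.18 («gauge field configurations with values in G = U(N)»), (22)–(23) p.21] -/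
theorem joined_one_unitary [Module.Finite ℂ 𝔸] (u : unitary 𝔸) : Joined (1 : unitary 𝔸) u := by
  obtain ⟨θ, hθ⟩ := exists_smul_norm_sub_one_lt_two u.2
  let v : unitary 𝔸 := ⟨(Circle.exp θ : ℂ) • (u : 𝔸), smul_mem_unitary (Circle.norm_coe _) u.2⟩
  have hv : ‖((v : unitary 𝔸) - 1 : 𝔸)‖ < 2 := hθ
  have h1v : Joined (1 : unitary 𝔸) v := Unitary.joined 1 v (by simpa using hv)
  have hvu : Joined v u := by
    refine ⟨{ toFun := fun s => ⟨(Circle.exp ((1 - (s : ℝ)) * θ) : ℂ) • (u : 𝔸), smul_mem_unitary (Circle.norm_coe _) u.2⟩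
              continuous_toFun := ?_
              source' := ?_
              target' := ?_ }⟩
    · refine Continuous.subtype_mk ?_ _
      exact ((continuous_subtype_val.comp (Circle.exp.continuous.comp
        ((continuous_const.sub continuous_subtype_val).mul continuous_const))).smul continuous_const)
    · apply Subtype.ext
      simp [v]
    · apply Subtype.ext
      simp
  exact h1v.trans hvu

/-- ★★ **`PathConnectedSpace (unitary 𝔸)`** for a finite-dimensional C⋆-algebra (stated as a theorem — no instance is registered by this file).
[cite: Balaban1985Averaging, p.18, (22)–(23) p.21] -/
theorem pathConnectedSpace_unitary [Module.Finite ℂ 𝔸] : PathConnectedSpace (unitary 𝔸) :=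
  ⟨⟨1⟩, fun u v => (joined_one_unitary u).symm.trans (joined_one_unitary v)⟩

/-- the embedding `unitary 𝔸 → 𝔸ˣ` is continuous (value and inverse = adjoint both continuous). [cite: Balaban1985Averaging, p.18 (bookkeeping)] -/
theorem continuous_toUnits : Continuous (Unitary.toUnits : unitary 𝔸 → 𝔸ˣ) :=
  Units.continuous_iff.2 ⟨continuous_subtype_val, continuous_subtype_val.star⟩

/-- ★★ **THE UNITARY UNITS `unitaryUnits 𝔸 ⊆ 𝔸ˣ` (print's gauge group `G`) FORM A PATH-CONNECTED SET** (finite-dimensional `𝔸`).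
[cite: Balaban1985Averaging, p.18 («G = U(N)»), (22)–(23) p.21] -/
theorem isPathConnected_unitaryUnits [Module.Finite ℂ 𝔸] : IsPathConnected (unitaryUnits 𝔸 : Set 𝔸ˣ) := by
  haveI := pathConnectedSpace_unitary (𝔸 := 𝔸)
  have h := (isPathConnected_univ (X := unitary 𝔸)).image continuous_toUnits
  convert h using 1
  ext x
  constructor
  · intro hx
    exact ⟨⟨(x : 𝔸), hx⟩, Set.mem_univ _, Units.ext rfl⟩
  · rintro ⟨u, -, rfl⟩
    exact u.2

end Unitary

/-! ## §2  The unitary gauge group of `ℤᵈ` and its orbits are path connected (product topology) -/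

section Gauge

variable {d : ℕ}

/-- ★★ **THE UNITARY GAUGE GROUP `{w : ℤᵈ → 𝔸ˣ | w(x) unitary}` IS PATH CONNECTED** (a product of path-connected sets, `IsPathConnected.pi`).
[cite: Balaban1985BackgroundPropagators, (3.28) p.395; Balaban1985Averaging, (8) p.18] -/
theorem isPathConnected_gaugeGroup [Module.Finite ℂ 𝔸] : IsPathConnected {w : Site d → 𝔸ˣ | ∀ z, w z ∈ unitaryUnits 𝔸} := by
  have hset : {w : Site d → 𝔸ˣ | ∀ z, w z ∈ unitaryUnits 𝔸} = Set.pi Set.univ (fun _ : Site d => (unitaryUnits 𝔸 : Set 𝔸ˣ)) := by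
    ext w
    simp only [Set.mem_setOf_eq, Set.mem_univ_pi, SetLike.mem_coe]
  rw [hset]
  exact IsPathConnected.pi fun _ => isPathConnected_unitaryUnits

omit [CStarAlgebra 𝔸] in
/-- the gauge action is continuous IN THE GAUGE for the product topologies (each bond variable `w(x)U(x, x+e_μ)w(x+e_μ)⁻¹` reads two coordinates of `w`).
[cite: Balaban1985BackgroundPropagators, (3.28) p.395 (bookkeeping)] -/
theorem continuous_gaugeAct_left {𝔸 : Type*} [NormedRing 𝔸] (U : Site d → Fin d → 𝔸ˣ) :
    Continuous fun w : Site d → 𝔸ˣ => gaugeAct w U := by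
  refine continuous_pi fun x => continuous_pi fun μ => ?_
  show Continuous fun w : Site d → 𝔸ˣ => w x * U x μ * (w (x + e μ))⁻¹
  exact ((continuous_apply x).mul continuous_const).mul (continuous_apply (x + e μ)).inv

/-- ★★ **EVERY UNITARY GAUGE ORBIT `{U^w | w unitary}` IS PATH CONNECTED**; in particular the PURE GAUGES `{1^w}`.
[cite: Balaban1985BackgroundPropagators, (3.28) p.395, (3.36) p.396] -/
theorem isPathConnected_orbit [Module.Finite ℂ 𝔸] (U : Site d → Fin d → 𝔸ˣ) :
    IsPathConnected ((fun w : Site d → 𝔸ˣ => gaugeAct w U) '' {w : Site d → 𝔸ˣ | ∀ z, w z ∈ unitaryUnits 𝔸}) :=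
  isPathConnected_gaugeGroup.image (continuous_gaugeAct_left U)

omit [CStarAlgebra 𝔸] in
/-- composition of gauge transformations: `(U^w)^{w′} = U^{w′w}`. [cite: Balaban1985Averaging, (8) p.18 (bookkeeping)] -/
theorem gaugeAct_gaugeAct {G : Type*} [Group G] (w' w : Site d → G) (V : Site d → Fin d → G) :
    gaugeAct w' (gaugeAct w V) = gaugeAct (w' * w) V := by
  funext x μ
  simp only [gaugeAct, Pi.mul_apply, mul_inv_rev]
  group

omit [CStarAlgebra 𝔸] in
/-- the trivial gauge acts trivially. [cite: Balaban1985Averaging, (8) p.18 (bookkeeping)] -/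
theorem gaugeAct_one_left {G : Type*} [Group G] (V : Site d → Fin d → G) : gaugeAct (1 : Site d → G) V = V := by
  funext x μ
  simp [gaugeAct]

end Gauge

/-! ## §3  The `δ`-neighbourhood of the pure-gauge orbit — (3.36)'s class «`U^u = e^{iηA}`, `|A|` small, for SOME unitary gauge `u`» on all of `ℤᵈ` — is ONE
path-connected, gauge-invariant family inside `𝒰′` containing the flat background -/

section OrbitBall

variable {d : ℕ}

/-- the flat background lies in the class (gauge `w = 1`). [cite: Balaban1985BackgroundPropagators, (3.36) p.396 (bookkeeping)] -/
theorem one_mem_orbitBall {δ : ℝ} (hδ0 : 0 < δ) :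
    (1 : Site d → Fin d → 𝔸ˣ) ∈ {U : Site d → Fin d → 𝔸ˣ | ∃ w : Site d → 𝔸ˣ, (∀ z, w z ∈ unitaryUnits 𝔸) ∧
      U ∈ (fun V => gaugeAct w V) '' {U : Site d → Fin d → 𝔸ˣ | (∀ x κ, U x κ ∈ unitaryUnits 𝔸) ∧ ∀ x κ, ‖((U x κ : 𝔸ˣ) : 𝔸) - 1‖ < δ}} :=
  ⟨1, fun _ => Subgroup.one_mem _, ⟨1, one_mem_ball hδ0, gaugeAct_one_left 1⟩⟩

/-- every gauge translate of the ball lies in the class. [cite: Balaban1985BackgroundPropagators, (3.36) p.396 (bookkeeping)] -/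
theorem image_ball_subset_orbitBall {δ : ℝ} {w : Site d → 𝔸ˣ} (hw : ∀ z, w z ∈ unitaryUnits 𝔸) :
    (fun V => gaugeAct w V) '' {U : Site d → Fin d → 𝔸ˣ | (∀ x κ, U x κ ∈ unitaryUnits 𝔸) ∧ ∀ x κ, ‖((U x κ : 𝔸ˣ) : 𝔸) - 1‖ < δ} ⊆
      {U : Site d → Fin d → 𝔸ˣ | ∃ w : Site d → 𝔸ˣ, (∀ z, w z ∈ unitaryUnits 𝔸) ∧
        U ∈ (fun V => gaugeAct w V) '' {U : Site d → Fin d → 𝔸ˣ | (∀ x κ, U x κ ∈ unitaryUnits 𝔸) ∧ ∀ x κ, ‖((U x κ : 𝔸ˣ) : 𝔸) - 1‖ < δ}} :=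
  fun _ hU => ⟨w, hw, hU⟩

/-- the pure-gauge orbit lies in the class (`δ > 0`). [cite: Balaban1985BackgroundPropagators, (3.36) p.396 (bookkeeping)] -/
theorem orbit_one_subset_orbitBall {δ : ℝ} (hδ0 : 0 < δ) :
    (fun w : Site d → 𝔸ˣ => gaugeAct w 1) '' {w : Site d → 𝔸ˣ | ∀ z, w z ∈ unitaryUnits 𝔸} ⊆
      {U : Site d → Fin d → 𝔸ˣ | ∃ w : Site d → 𝔸ˣ, (∀ z, w z ∈ unitaryUnits 𝔸) ∧
        U ∈ (fun V => gaugeAct w V) '' {U : Site d → Fin d → 𝔸ˣ | (∀ x κ, U x κ ∈ unitaryUnits 𝔸) ∧ ∀ x κ, ‖((U x κ : 𝔸ˣ) : 𝔸) - 1‖ < δ}} := by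
  rintro _ ⟨w, hw, rfl⟩
  exact ⟨w, hw, gaugeAct_one_mem_image_ball w hδ0⟩

/-- ★ **THE CLASS IS GAUGE INVARIANT** (`(V^w)^{w′} = V^{w′w}`, `w′w` unitary). [cite: Balaban1985RegularSpaces, (1.7) p.77 («invariant with respect to gauge transformations»); Balaban1985BackgroundPropagators, (3.28) p.395] -/
theorem gaugeAct_mem_orbitBall {δ : ℝ} {w' : Site d → 𝔸ˣ} (hw' : ∀ z, w' z ∈ unitaryUnits 𝔸) {U : Site d → Fin d → 𝔸ˣ}
    (hU : U ∈ {U : Site d → Fin d → 𝔸ˣ | ∃ w : Site d → 𝔸ˣ, (∀ z, w z ∈ unitaryUnits 𝔸) ∧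
      U ∈ (fun V => gaugeAct w V) '' {U : Site d → Fin d → 𝔸ˣ | (∀ x κ, U x κ ∈ unitaryUnits 𝔸) ∧ ∀ x κ, ‖((U x κ : 𝔸ˣ) : 𝔸) - 1‖ < δ}}) :
    gaugeAct w' U ∈ {U : Site d → Fin d → 𝔸ˣ | ∃ w : Site d → 𝔸ˣ, (∀ z, w z ∈ unitaryUnits 𝔸) ∧
      U ∈ (fun V => gaugeAct w V) '' {U : Site d → Fin d → 𝔸ˣ | (∀ x κ, U x κ ∈ unitaryUnits 𝔸) ∧ ∀ x κ, ‖((U x κ : 𝔸ˣ) : 𝔸) - 1‖ < δ}} := by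
  obtain ⟨w, hw, V, hV, rfl⟩ := hU
  exact ⟨w' * w, fun z => Subgroup.mul_mem _ (hw' z) (hw z), V, hV, (gaugeAct_gaugeAct w' w V).symm⟩

/-- ★★ **THE CLASS LIES IN THE REGIME `𝒰′`** when `4δ < (α_Q∕L²)L^{−2m}` (`L ≥ 1`; translate by translate, the companion's `image_ball_subset_reg17UnivP`).
[cite: Balaban1985RegularSpaces, (1.7) p.77; Balaban1985BackgroundPropagators, (3.36) p.396] -/
theorem orbitBall_subset_reg17UnivP [Nontrivial 𝔸] {L : ℕ} (hL : 1 ≤ L) (m : ℕ) {δ : ℝ}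
    (hδ : 4 * δ < alphaQ d L / (L : ℝ) ^ 2 * (((L : ℝ) ^ m)⁻¹) ^ 2) :
    {U : Site d → Fin d → 𝔸ˣ | ∃ w : Site d → 𝔸ˣ, (∀ z, w z ∈ unitaryUnits 𝔸) ∧
      U ∈ (fun V => gaugeAct w V) '' {U : Site d → Fin d → 𝔸ˣ | (∀ x κ, U x κ ∈ unitaryUnits 𝔸) ∧ ∀ x κ, ‖((U x κ : 𝔸ˣ) : 𝔸) - 1‖ < δ}} ⊆
      {U₀ : Site d → Fin d → 𝔸ˣ | (∀ x κ, U₀ x κ ∈ unitaryUnits 𝔸) ∧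
        Reg17 L m (fun _ => (Set.univ : Set (Site d))) (alphaQ d L / (L : ℝ) ^ 2) U₀} := by
  rintro U ⟨w, hw, hU⟩
  exact image_ball_subset_reg17UnivP hL m hδ hw hU

/-- ★★★ **THE `δ`-NEIGHBOURHOOD OF THE PURE-GAUGE ORBIT IS PATH CONNECTED** (`0 < δ ≤ 2`, finite-dimensional `𝔸`): a point `V^w` of the class is joined to
the pure gauge `1^w` inside the translate `(B_δ)^w` (the companion's radial path), and `1^w` to `1` inside the pure-gauge orbit (§2) — both inside the class.
[cite: Balaban1985BackgroundPropagators, Thm 3.11 p.416, (3.36) p.396; Balaban1985Averaging, (22)–(23) p.21] -/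
theorem isPathConnected_orbitBall [Module.Finite ℂ 𝔸] {δ : ℝ} (hδ0 : 0 < δ) (hδ2 : δ ≤ 2) :
    IsPathConnected {U : Site d → Fin d → 𝔸ˣ | ∃ w : Site d → 𝔸ˣ, (∀ z, w z ∈ unitaryUnits 𝔸) ∧
      U ∈ (fun V => gaugeAct w V) '' {U : Site d → Fin d → 𝔸ˣ | (∀ x κ, U x κ ∈ unitaryUnits 𝔸) ∧ ∀ x κ, ‖((U x κ : 𝔸ˣ) : 𝔸) - 1‖ < δ}} := by
  refine ⟨1, one_mem_orbitBall hδ0, ?_⟩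
  rintro U ⟨w, hw, hUw⟩
  -- `1` to `1^w` inside the pure-gauge orbit
  have horb := isPathConnected_orbit (𝔸 := 𝔸) (1 : Site d → Fin d → 𝔸ˣ)
  have h1 : (1 : Site d → Fin d → 𝔸ˣ) ∈ (fun w : Site d → 𝔸ˣ => gaugeAct w 1) '' {w : Site d → 𝔸ˣ | ∀ z, w z ∈ unitaryUnits 𝔸} :=
    ⟨1, fun _ => Subgroup.one_mem _, gaugeAct_one_left 1⟩
  have h1w : gaugeAct w 1 ∈ (fun w : Site d → 𝔸ˣ => gaugeAct w 1) '' {w : Site d → 𝔸ˣ | ∀ z, w z ∈ unitaryUnits 𝔸} := ⟨w, hw, rfl⟩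
  have j1 : JoinedIn _ 1 (gaugeAct w 1) := (horb.joinedIn 1 h1 (gaugeAct w 1) h1w).mono (orbit_one_subset_orbitBall hδ0)
  -- `1^w` to `U` inside the translate of the ball
  obtain ⟨V, hV, rfl⟩ := hUw
  have j2 : JoinedIn _ (gaugeAct w 1) (gaugeAct w V) := (joinedIn_image_ball_gaugeAct_one w hδ2 hV).mono (image_ball_subset_orbitBall hw)
  exact j1.trans j2

/-- … hence PRECONNECTED — the family hypothesis of the continuity-method reduction, now for ONE gauge-invariant class containing `1` and every background
`δ`-close to a pure gauge modulo gauge. [cite: Balaban1985BackgroundPropagators, Thm 3.11 p.416, (3.36) p.396] -/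
theorem isPreconnected_orbitBall [Module.Finite ℂ 𝔸] {δ : ℝ} (hδ0 : 0 < δ) (hδ2 : δ ≤ 2) :
    IsPreconnected {U : Site d → Fin d → 𝔸ˣ | ∃ w : Site d → 𝔸ˣ, (∀ z, w z ∈ unitaryUnits 𝔸) ∧
      U ∈ (fun V => gaugeAct w V) '' {U : Site d → Fin d → 𝔸ˣ | (∀ x κ, U x κ ∈ unitaryUnits 𝔸) ∧ ∀ x κ, ‖((U x κ : 𝔸ˣ) : 𝔸) - 1‖ < δ}} :=
  (isPathConnected_orbitBall hδ0 hδ2).isConnected.isPreconnected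

end OrbitBall

/-! ## §4  The continuity-method reduction RUN on the class (dag-n06-w4 g3 `B9Thm311ContinuityMethodZd` by name, base point `1`) -/

section ContinuityMethod

open B9SupplySockB9P3ZdLetters (OpsZd deltaAOf)
open B9SupplySockB9P3ZdAllLettersZd (opsAllZd)
open B9Eq327GreenZd (bondPair)
open B9Eq327GreenZdHerm (domSubH RegularAtH)
open B9Thm311ContinuityMethodZd (bondPair_pos_on_reg17UnivP_of_coercive regularAtH_on_reg17UnivP_of_coercive)
open B8Eq131CubesAdmissible (cubeFam)
open B8CubeMemberZd (cubeLamS)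
open B8Ineq159FlatCubeMemberPrinted (cubeLamBP)
open B8LeafModelZd (ZdIdx)

variable {d : ℕ} {𝔸 : Type*} [CStarAlgebra 𝔸] [FiniteDimensional ℝ 𝔸] [Nontrivial 𝔸] {L : ℕ}
variable (τ : 𝔸 →ₗ[ℂ] ℂ) (hτp : ∀ a : 𝔸, a ≠ 0 → 0 < (τ (star a * a)).re)
  (hτt : ∀ a b : 𝔸, τ (a * b) = τ (b * a)) (hτs : ∀ a : 𝔸, τ (star a) = starRingEnd ℂ (τ a))

omit [Nontrivial 𝔸] in
/-- a finite-dimensional (over `ℝ`) C⋆-algebra is a finite `ℂ`-module. [folklore] [cite: Balaban1985Averaging, p.18 (bookkeeping)] -/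
theorem moduleFinite_complex : Module.Finite ℂ 𝔸 := Module.Finite.of_restrictScalars_finite ℝ ℂ 𝔸

include hτp hτt hτs in
/-- ★★★ **THEOREM 3.11 ON THE WHOLE `δ`-NEIGHBOURHOOD OF THE PURE-GAUGE ORBIT, FROM THE A-PRIORI BOUND** — at every cube member (class `cubeLamBP`, `m ≤ k`,
`2 ≤ d`, `2 ≤ L ≤ ρ`), for `0 < δ` with `4δ < (α_Q∕L²)L^{−2m}`: the class `𝒩_δ = {V^w : V unitary with sup_b ‖V(b) − 1‖ < δ, w unitary}` is ONE preconnected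
family inside `𝒰′` containing `1` (§3), so dag-n06-w4 g3's `bondPair_pos_on_reg17UnivP_of_coercive` applies to it VERBATIM: uniform coercivity at the positive
points of `𝒩_δ` ⟹ the genuine `Δ_a(U₀)` is positive definite on `E_𝔤(□₀)` for EVERY `U₀ ∈ 𝒩_δ`.
[cite: Balaban1985BackgroundPropagators, Thm 3.11 p.416, (3.36) p.396, (3.115) p.418; Balaban1985RegularSpaces, (1.7) p.77, (1.131) p.99] -/
theorem bondPair_pos_on_orbitBall_of_coercive (hd2 : 2 ≤ d) (hL2 : 2 ≤ L) (ops₀ : ℝ → ZdIdx d L → ℕ → OpsZd d 𝔸) (M : ℝ)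
    (i : ZdIdx d L) {a : Site d} {Mc ρ : ℕ} (hΩ : i.Ω = cubeFam false L a Mc ρ i.k) (hΛs : i.Λs = cubeLamS L a Mc ρ i.k) (hρ : L ≤ ρ)
    {m : ℕ} (hm : m ≤ i.k) {δ : ℝ} (hδ0 : 0 < δ) (hδ : 4 * δ < alphaQ d L / (L : ℝ) ^ 2 * (((L : ℝ) ^ m)⁻¹) ^ 2) {c : ℝ} (hc : 0 < c)
    (hcoer : ∀ U₀ ∈ {U : Site d → Fin d → 𝔸ˣ | ∃ w : Site d → 𝔸ˣ, (∀ z, w z ∈ unitaryUnits 𝔸) ∧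
        U ∈ (fun V => gaugeAct w V) '' {U : Site d → Fin d → 𝔸ˣ | (∀ x κ, U x κ ∈ unitaryUnits 𝔸) ∧ ∀ x κ, ‖((U x κ : 𝔸ˣ) : 𝔸) - 1‖ < δ}},
      (∀ A ∈ domSubH (𝔸 := 𝔸) (i.Ω 0), A ≠ 0 → 0 < bondPair τ A (deltaAOf i.η (opsAllZd τ L (cubeLamBP L a Mc ρ i.k) ops₀ M i m) U₀ A)) →
        ∀ A ∈ domSubH (𝔸 := 𝔸) (i.Ω 0), c * bondPair τ A A ≤ bondPair τ A (deltaAOf i.η (opsAllZd τ L (cubeLamBP L a Mc ρ i.k) ops₀ M i m) U₀ A)) :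
    ∀ U₀ ∈ {U : Site d → Fin d → 𝔸ˣ | ∃ w : Site d → 𝔸ˣ, (∀ z, w z ∈ unitaryUnits 𝔸) ∧
        U ∈ (fun V => gaugeAct w V) '' {U : Site d → Fin d → 𝔸ˣ | (∀ x κ, U x κ ∈ unitaryUnits 𝔸) ∧ ∀ x κ, ‖((U x κ : 𝔸ˣ) : 𝔸) - 1‖ < δ}},
      ∀ A ∈ domSubH (𝔸 := 𝔸) (i.Ω 0), A ≠ 0 → 0 < bondPair τ A (deltaAOf i.η (opsAllZd τ L (cubeLamBP L a Mc ρ i.k) ops₀ M i m) U₀ A) := by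
  haveI : NeZero L := ⟨by omega⟩
  haveI : Module.Finite ℂ 𝔸 := moduleFinite_complex
  have hL1 : 1 ≤ L := le_trans (by norm_num) hL2
  exact bondPair_pos_on_reg17UnivP_of_coercive τ hτp hτt hτs hd2 hL2 ops₀ M i hΩ hΛs hρ hm (orbitBall_subset_reg17UnivP hL1 m hδ)
    (isPreconnected_orbitBall hδ0 (delta_le_two_of_window hL1 hδ)) (one_mem_orbitBall hδ0) hc hcoer

include hτp hτt hτs in
/-- ★★★ **… AND THEN `G_𝔤(U₀)` EXISTS FOR EVERY `U₀` OF THE CLASS.** [cite: Balaban1985BackgroundPropagators, Thm 3.11 p.416, (3.27) p.395, (3.115) p.418] -/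
theorem regularAtH_on_orbitBall_of_coercive (hd2 : 2 ≤ d) (hL2 : 2 ≤ L) (ops₀ : ℝ → ZdIdx d L → ℕ → OpsZd d 𝔸) (M : ℝ)
    (i : ZdIdx d L) {a : Site d} {Mc ρ : ℕ} (hΩ : i.Ω = cubeFam false L a Mc ρ i.k) (hΛs : i.Λs = cubeLamS L a Mc ρ i.k) (hρ : L ≤ ρ)
    {m : ℕ} (hm : m ≤ i.k) {δ : ℝ} (hδ0 : 0 < δ) (hδ : 4 * δ < alphaQ d L / (L : ℝ) ^ 2 * (((L : ℝ) ^ m)⁻¹) ^ 2) {c : ℝ} (hc : 0 < c)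
    (hcoer : ∀ U₀ ∈ {U : Site d → Fin d → 𝔸ˣ | ∃ w : Site d → 𝔸ˣ, (∀ z, w z ∈ unitaryUnits 𝔸) ∧
        U ∈ (fun V => gaugeAct w V) '' {U : Site d → Fin d → 𝔸ˣ | (∀ x κ, U x κ ∈ unitaryUnits 𝔸) ∧ ∀ x κ, ‖((U x κ : 𝔸ˣ) : 𝔸) - 1‖ < δ}},
      (∀ A ∈ domSubH (𝔸 := 𝔸) (i.Ω 0), A ≠ 0 → 0 < bondPair τ A (deltaAOf i.η (opsAllZd τ L (cubeLamBP L a Mc ρ i.k) ops₀ M i m) U₀ A)) →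
        ∀ A ∈ domSubH (𝔸 := 𝔸) (i.Ω 0), c * bondPair τ A A ≤ bondPair τ A (deltaAOf i.η (opsAllZd τ L (cubeLamBP L a Mc ρ i.k) ops₀ M i m) U₀ A)) :
    ∀ U₀ ∈ {U : Site d → Fin d → 𝔸ˣ | ∃ w : Site d → 𝔸ˣ, (∀ z, w z ∈ unitaryUnits 𝔸) ∧
        U ∈ (fun V => gaugeAct w V) '' {U : Site d → Fin d → 𝔸ˣ | (∀ x κ, U x κ ∈ unitaryUnits 𝔸) ∧ ∀ x κ, ‖((U x κ : 𝔸ˣ) : 𝔸) - 1‖ < δ}},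
      RegularAtH i.η (opsAllZd τ L (cubeLamBP L a Mc ρ i.k) ops₀ M i m) (i.Ω 0) U₀ := by
  haveI : NeZero L := ⟨by omega⟩
  haveI : Module.Finite ℂ 𝔸 := moduleFinite_complex
  have hL1 : 1 ≤ L := le_trans (by norm_num) hL2
  exact regularAtH_on_reg17UnivP_of_coercive τ hτp hτt hτs hd2 hL2 ops₀ M i hΩ hΛs hρ hm (orbitBall_subset_reg17UnivP hL1 m hδ)
    (isPreconnected_orbitBall hδ0 (delta_le_two_of_window hL1 hδ)) (one_mem_orbitBall hδ0) hc hcoer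

end ContinuityMethod

end Literature.MathematicalPhysics.QuantumFieldTheory.Balaban1983to89.B9Eq336GaugeOrbitConnectedZd

end
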